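import Literature.Computability.AlgebraicComplexity.MS2001ClassVarieties
import Mathlib.LinearAlgebra.Matrix.Transvection
import HarnessLib

/-!
# GCT I §4.2: the structure of interior limit points — `f' = τ(g')`, `τ` a `0/1`-diagonal
# degeneration `τ = lim_{t → 0} τ(t)` — PROOF

Topic `Computability/AlgebraicComplexity`. Cell `val-lit`, row MS2001-A (K. Mulmuley, M. Sohoni,
*Geometric complexity theory I*, SIAM J. Comput. 31 (2001) 496–526), §4.2, typed from the
AUTHORS' VERSION (AV; text of record `HOME/bip/texts/MS2001-authorversion/`, locators «AV p.N,
all.txt Lnnnn»). Companion of `MS2001ClassVarieties.lean` §4.2 (`IsInteriorLimitPoint g f :=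
f ∈ End · g`, `IsExteriorLimitPoint`, `IsInteriorLimitPoint.hasDetRepr`). Theorems and two bodied
definitions (the print's `τ` and `τ(t)`): no named facts, no instances, no `sorry`.

## The source (AV p.17, all.txt L1161–1183)

> "If `f` is an interior limit point of `Δ[g]`, then `f = det(σY)` [read: `f = σ · g`], where `σ`
> is possibly singular. Since diagonalizable matrices are dense in `M_{m²}(F)`, it follows that
> some conjugate `f'` of `f` is of the form `τ(g')`, `τ` is diagonal, and `g'` is some conjugate
> of `g`. Let `τ(t)` be the one-parameter subgroup obtained by replacing the zero diagonal
> entries of `τ` by `t`. Then `τ = lim_{t→0} τ(t)`. We shall now give an example of a point `f`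
> in `Δ[g]`, which is of the form `lim_{t→0} det(α(t)Y)` for some one parameter group `α(t)`,
> but it is not expected to be of the form `τ(g)`, where `τ = lim_{t→0} τ(t)` for some one
> parameter group `τ(t)`."

## Contents

* `MS2001Sec42.coordProj S` — the print's `τ`: the diagonal `0/1` matrix keeping the variables
  in `S` and killing the others (after the normalisation below, the nonzero diagonal entries of
  `τ` are `1`); `MS2001Sec42.coordProjFamily S t` — the print's `τ(t)` ("replacing the zero
  diagonal entries of `τ` by `t`"), with `coordProjFamily_zero : τ(0) = τ`,
  `det_coordProjFamily : det τ(t) = t^{#Sᶜ}` (so `τ(t) ∈ GL` for `t ≠ 0`,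
  `linSubst_coordProjFamily_mem_glOrbit`).
* **`MS2001_sec_4_2_isInteriorLimitPoint_iff`** — PROVED, over every field: `f` is an interior
  limit point of `Δ[g]` (`f = σ · g`, `σ ∈ End`) iff `f = P · (τ_S · (Q · g))` for some
  INVERTIBLE `P, Q` and some coordinate set `S`; i.e. ("some conjugate `f' = P⁻¹ · f` of `f` is
  of the form `τ(g')`, `τ` diagonal `0/1`, `g' = Q · g` a translate of `g`",
  `IsInteriorLimitPoint.exists_coordProj`). The print's "diagonalizable matrices are dense"
  is replaced by the exact statement it is used for: every square matrix over a field is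
  `P · diag(d) · Q` with `P, Q` products of transvections (Mathlib's
  `Matrix.Pivot.exists_list_transvec_mul_diagonal_mul_list_transvec`, Gaussian elimination), and
  `diag(d) = diag(d') · τ_S` with `d'` invertible (`d'_i = d_i` or `1`) and `S = {i : d_i ≠ 0}`.

## Rendering (disclosed)

* "conjugate" in the print means a translate under the group (`f' = P⁻¹ · f`, `g' = Q · g` with
  `P, Q ∈ GL`), not a similarity transform; typed as such.
* The interior/exterior vocabulary and `Δ[g] = orbitClosure g`, `End · g = endOrbit σ k g`,
  `P · f = linSubst σ k P f` are the tree's (`MS2001ClassVarieties.lean`, `LinSubst.lean`); the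
  composition rule is `linSubst (P * Q) = linSubst P ∘ linSubst Q` (`linSubst_mul`).
* The example announced in the last quoted sentence (the Tutte-matrix point `h(Y)`) is the
  device `map_eval_zero_mem_orbitClosure_of_family` of `MS2001ClassVarieties.lean`; that `h(Y)`
  is NOT of the form `τ(g')` is a conjecture of the print ("not expected") and is not typed.

Honest framing: literature typing (linear algebra); nothing here bears on any separation
(`VP ≠ VNP` is NOT proved).

## References

* [MulmuleySohoniSIAM2001] K. Mulmuley, M. Sohoni, *Geometric complexity theory I*, SIAM J.
  Comput. 31 (2001) 496–526, §4.2 (AV p.17, all.txt L1161–1183).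
-/

noncomputable section

open MvPolynomial Matrix

namespace Literature.Computability.AlgebraicComplexity

universe u v

variable {k : Type u} [Field k] {σ : Type v} [Fintype σ] [DecidableEq σ]

/-! ## §1. The degenerations `τ` and the one-parameter family `τ(t)` -/

/-- The print's `τ` (AV p.17 L1163–1164), normalised: the diagonal matrix with entry `1` at the
coordinates in `S` and `0` elsewhere — as a substitution it keeps the variables in `S` and sets
the others to zero. [cite: MulmuleySohoniSIAM2001, §4.2 (AV p.17, all.txt L1163–1164)] -/
def MS2001Sec42.coordProj (S : Finset σ) : Matrix σ σ k :=
  diagonal fun i => if i ∈ S then 1 else 0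

/-- The print's `τ(t)` (AV p.17 L1164–1166: "the one-parameter subgroup obtained by replacing the
zero diagonal entries of `τ` by `t`"). [cite: MulmuleySohoniSIAM2001, §4.2 (AV p.17, all.txt L1164–1166)] -/
def MS2001Sec42.coordProjFamily (S : Finset σ) (t : k) : Matrix σ σ k :=
  diagonal fun i => if i ∈ S then 1 else t

open MS2001Sec42

omit [Fintype σ] in
/-- "`τ = lim_{t→0} τ(t)`": the family at `t = 0` is `τ`. [cite: MulmuleySohoniSIAM2001, §4.2 (AV p.17, all.txt L1166)] -/
theorem MS2001Sec42.coordProjFamily_zero (S : Finset σ) :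
    coordProjFamily S (0 : k) = coordProj S := rfl

/-- `det τ(t) = t^{#Sᶜ}`; in particular `τ(t)` is invertible for `t ≠ 0` (a one-parameter family
in `GL`). [cite: MulmuleySohoniSIAM2001, §4.2 (AV p.17, all.txt L1164–1166)] -/
theorem MS2001Sec42.det_coordProjFamily (S : Finset σ) (t : k) :
    (coordProjFamily S t).det = t ^ Sᶜ.card := by
  rw [coordProjFamily, det_diagonal, Finset.prod_ite, Finset.prod_const_one, one_mul,
    Finset.prod_const]
  congr 1
  rw [Finset.card_compl, Finset.filter_not, Finset.card_sdiff_of_subset (Finset.filter_subset _ _),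
    Finset.card_univ, Finset.filter_mem_eq_inter, Finset.univ_inter]

/-- For `t ≠ 0`, `τ(t) · h` lies in the `GL`-orbit of `h`. [cite: MulmuleySohoniSIAM2001, §4.2 (AV p.17, all.txt L1164–1166)] -/
theorem MS2001Sec42.linSubst_coordProjFamily_mem_glOrbit (S : Finset σ) {t : k} (ht : t ≠ 0)
    (h : MvPolynomial σ k) : linSubst σ k (coordProjFamily S t) h ∈ glOrbit σ k h := by
  have hdet : (coordProjFamily S t).det ≠ 0 := by
    rw [det_coordProjFamily]
    exact pow_ne_zero _ ht
  exact ⟨Matrix.GeneralLinearGroup.mkOfDetNeZero _ hdet, rfl⟩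

/-! ## §2. Interior limit points are `P · τ_S · Q · g` -/

open scoped Classical in
/-- Normalising a diagonal matrix: `diag(d) = diag(d') · τ_S` with `S = {i : d_i ≠ 0}` and
`d'_i = d_i` on `S`, `1` off `S` (so `d'` is invertible). [folklore] -/
private theorem MS2001Sec42.diagonal_eq_mul_coordProj (d : σ → k) :
    diagonal d = diagonal (fun i => if d i ≠ 0 then d i else 1) *
      coordProj (Finset.univ.filter fun i => d i ≠ 0) := by
  rw [coordProj, diagonal_mul_diagonal]
  congr 1
  funext i
  by_cases hi : d i = 0
  · rw [if_neg (not_not.2 hi), if_neg (by simp [hi]), hi, mul_zero]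
  · rw [if_pos hi, if_pos (by simp [hi]), mul_one]

/-- **GCT I §4.2: the structure of interior limit points** (AV p.17, all.txt L1161–1166),
PROVED over every field: `f` is an interior limit point of `Δ[g]` — `f = σ · g` for a possibly
singular `σ` — if and only if `f = P · (τ_S · (Q · g))` for some invertible `P, Q` and some
set `S` of coordinates, `τ_S` the diagonal `0/1` degeneration keeping the variables in `S`
("some conjugate `f'` of `f` is of the form `τ(g')`, `τ` is diagonal, and `g'` is some conjugate
of `g`"). (`σ = L · diag(d) · L'` by Gaussian elimination with `L, L'` products of
transvections, and `diag(d) = diag(d') · τ_S`.)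
[cite: MulmuleySohoniSIAM2001, §4.2 (AV p.17, all.txt L1161–1166)] -/
theorem MS2001_sec_4_2_isInteriorLimitPoint_iff (g f : MvPolynomial σ k) :
    IsInteriorLimitPoint g f ↔ ∃ (P Q : Matrix σ σ k) (S : Finset σ), P.det ≠ 0 ∧ Q.det ≠ 0 ∧
      f = linSubst σ k P (linSubst σ k (coordProj S) (linSubst σ k Q g)) := by
  classical
  constructor
  · rintro ⟨A, rfl⟩
    obtain ⟨L, L', d, hA⟩ := Matrix.Pivot.exists_list_transvec_mul_diagonal_mul_list_transvec A
    refine ⟨(L.map TransvectionStruct.toMatrix).prod * diagonal (fun i => if d i ≠ 0 then d i else 1),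
      (L'.map TransvectionStruct.toMatrix).prod, Finset.univ.filter (fun i => d i ≠ 0), ?_, ?_, ?_⟩
    · rw [det_mul, TransvectionStruct.det_toMatrix_prod, one_mul, det_diagonal]
      exact Finset.prod_ne_zero_iff.2 fun i _ => by
        by_cases hi : d i ≠ 0
        · rw [if_pos hi]; exact hi
        · rw [if_neg hi]; exact one_ne_zero
    · rw [TransvectionStruct.det_toMatrix_prod]
      exact one_ne_zero
    · change linSubst σ k A g = _
      rw [hA, diagonal_eq_mul_coordProj d, ← Matrix.mul_assoc, linSubst_mul, linSubst_mul,
        linSubst_mul]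
      rfl
  · rintro ⟨P, Q, S, -, -, rfl⟩
    refine ⟨P * coordProj S * Q, ?_⟩
    show linSubst σ k (P * coordProj S * Q) g = _
    rw [linSubst_mul, linSubst_mul]
    rfl

/-- **"Some conjugate `f'` of `f` is of the form `τ(g')`, `τ` diagonal, `g'` some conjugate of
`g`"** (AV p.17 L1163–1164), in orbit language: for an interior limit point `f` of `Δ[g]` there
are `f' ∈ GL · f`, `g' ∈ GL · g` and a coordinate set `S` with `f' = τ_S · g'` — and
`τ_S = τ(0)` for the one-parameter family `τ(t) ⊆ GL` (`coordProjFamily_zero`,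
`linSubst_coordProjFamily_mem_glOrbit`). [cite: MulmuleySohoniSIAM2001, §4.2 (AV p.17, all.txt L1161–1166)] -/
theorem IsInteriorLimitPoint.exists_coordProj {g f : MvPolynomial σ k}
    (h : IsInteriorLimitPoint g f) :
    ∃ f' ∈ glOrbit σ k f, ∃ g' ∈ glOrbit σ k g, ∃ S : Finset σ,
      f' = linSubst σ k (coordProj S) g' := by
  obtain ⟨P, Q, S, hP, hQ, hf⟩ := (MS2001_sec_4_2_isInteriorLimitPoint_iff g f).1 h
  refine ⟨linSubst σ k P⁻¹ f, ⟨Matrix.GeneralLinearGroup.mkOfDetNeZero P⁻¹ (by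
      rw [det_nonsing_inv, Ring.inverse_eq_inv]; exact inv_ne_zero hP), rfl⟩,
    linSubst σ k Q g, ⟨Matrix.GeneralLinearGroup.mkOfDetNeZero Q hQ, rfl⟩, S, ?_⟩
  rw [hf, ← AlgHom.comp_apply, ← linSubst_mul, nonsing_inv_mul _ (isUnit_iff_ne_zero.2 hP),
    linSubst_one, AlgHom.id_apply]

end Literature.Computability.AlgebraicComplexity
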